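import Literature.AnabelianGeometry.EtaleTheta.ConstantMultipleDivisors
import Literature.AlgebraicGeometry.Frobenioids.PreFrobenioidDataOfModel
import Literature.AlgebraicGeometry.Frobenioids.PreFrobenioidDataOfFunctor
import Literature.AlgebraicGeometry.Frobenioids.ModelFrobenioidBaseSectionThrough
import Literature.AlgebraicGeometry.Frobenioids.ModelFrobenioidPreFrobenioid
import Literature.AlgebraicGeometry.Frobenioids.ModelFrobenioidUnits
import HarnessLib

/-!
# [EtTh] Corollary 5.12 (i), (ii) for a MODEL tempered Frobenioid: the printed proof (p.340 l.−8 – p.341 l.9 / PDF pp.114–115) kernel-checked from its [FrdI] Thm. 5.2 inputs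

Mochizuki, *The étale theta function and its Frobenioid-theoretic manifestations*, Publ. RIMS **45** (2009),
Corollary 5.12 (i) "The isomorphism classes of `A_N`, `B_N`, and `B_{N'}` are distinct", (ii) "There exists a
linear morphism `ι : B_{N'} → B_N`" (pp.339–340 (PDF pp.113–114)) and their proof (p.340 l.−8 – p.341 l.9
(PDF pp.114–115)) [cite: MochizukiEtTh2009, Cor 5.12 (i)(ii) p.339–341 (PDF pp.113–115)]; *The geometry of
Frobenioids I*, Kyushu J. Math. **62** (2008), Thm. 5.2 (the model Frobenioid)
[cite: MochizukiFrdI2008, Thm. 5.2 p.100–101].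

abc-iut cell, block F (fact-proving wave), seat abc-iut-f-112 (gen 2), FACT-LIST rows F-0505
(`ConstantMultiple.IsoClassesDistinct`), F-0503 (`ConstantMultiple.ExistsLinearIota`), F-0501 / F-0502 (the
conditional (iii) / conjunction); plan/L2/SUBDAG-EtTh-Cor512.md rows C512-L04 / L05 ("TYPED, OPEN —
dischargeable only at the MODEL").  PROOF-ONLY companion of abc-iut-L2-t4's `ConstantMultipleIndeterminacy.lean`:
no definition, no `Prop` fact, no instance; nothing landed is edited.  Pattern = abc-iut-L2-d4's
`Discharge/Sec5ModelCase.lean`: by [EtTh] Def. 3.6 (ii) (p.303 (PDF p.77)) the tempered Frobenioid `C` of §5 IS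
the model Frobenioid ([FrdI] Thm. 5.2) of data `(D, Φ, B, Div_B : B → Φ^gp)`, i.e. the tree's
`ModelFrobenioid Φ B Div_B` (abc-iut-L1) with operations `PreFrobenioidData.ofModel Φ B Div_B`; a §5 datum
`𝔉 : ThetaFrobenioid (ModelFrobenioid Φ B Div_B) D` "of this kind" is one with `𝔉.pre = PreFrobenioidData.ofModel Φ B Div_B`
(abc-iut-L2-t9's `TemperedFrobenioidStub.ofModel`).  The universal closures of (i)/(ii) over the DATA-ONLY
§5 interface are false (gen 0, `Discharge/Sec5Cor512UniversalClosureRefuted.lean`, p428826); here are the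
R5 INSTANCE FORMS at the model, each from the inputs the printed proof names:

* `Model.exists_linear_of_div_eq_one` / **`ConstantMultiple.RootMorphismData.existsLinearIota_of_model`** —
  (ii) from: "the Frobenius-trivial object" `A_{N'}` (the `N'`-domain, Prop. 4.2 (iii) / Def. 4.1 (iv) (a);
  [FrdI] Def. 1.2 (iv), the tree's `IsFrobeniusTrivial`), `s^⊓_{N'}` a pre-step (Prop. 4.2 (iii) "`s_N`, `s_N`
  … are base-equivalent pre-steps"; the tree's `IsPreStep`), `B` group-like ([FrdI] Thm. 5.2 (ii) standing
  hypothesis).  The morphism is print's "`(M−1)`-th tensor power of the section … that determines …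
  `s^⊓_{N'}`" (p.341 l.6–8): `ι := (1, β^bs, x^{M−1}, u)` where `of(x) · Div_B(·)` is the class of `B_{N'}` read
  through the linear base-isomorphism `s^⊓_{N'}` from the principal class of `A_{N'}`.
* `Model.isEmpty_iso_of_principal`, `Model.isEmpty_iso_of_isometry`,
  **`ConstantMultiple.RootMorphismData.isoClassesDistinct_of_model`** — (i) from: `A_N` Frobenius-trivial
  (p.341 l.9 "the Frobenius-trivial object `A_N`"); "all positive tensor powers of these line bundles are
  nontrivial" (p.341 l.5–6) in its model form `cls(B_{N'})^k ∉ Div_B(B(B_{N'}^bs))` (`k ≥ 1`) and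
  `cls(B_N) ∉ Div_B(B(B_N^bs))`; "the isomorphism classes of these line bundles are preserved by arbitrary
  automorphisms of `B^bs_N`" (p.341 l.6–9) = Aut-ampleness of `B_N` (abc-iut-L2-t4's `AutAmpleBN`, p.330
  (PDF p.104) "it follows that `B_N` is Aut-ample"; PROVED from `SgpCapSection` in `Sec5AutAmple.lean`); `Φ`
  divisorial ([FrdI] Thm. 5.2); `β_{N,N'}` an isometry of Frobenius degree `M ≥ 2` (the datum); AND ONE INPUT
  PRINT DOES NOT NAME: every `D`-endomorphism of `B_N^bs` is an isomorphism (`hEnd`).  WHY `hEnd`: an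
  isomorphism `h : B_N ⥲ B_{N'}` composed with `β_{N,N'} : B_{N'} → B_N` gives an isometric ENDOMORPHISM of
  `B_N` of Frobenius degree `M` over the `D`-ENDOMORPHISM `h^bs ∘ β^bs` of `B_N^bs`; print's "preserved by
  arbitrary automorphisms" applies to it only if that endomorphism is an automorphism — true for the
  tempered coverings of §5 (connected objects of the temperoid `D`, [SemiAnbd] §3) but not a consequence of
  the other inputs: over a one-object base with a non-invertible endomorphism `φ`, `Φ(φ) = (·)^M`, the data
  `B_N := B_{N'} := (∗, 1)`, `β := (M, φ, 0, 1)`, `A_N := (∗, 0)` satisfy every other hypothesis with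
  `B_N = B_{N'}` (recorded here in prose; not needed by the theorems).
* **`constantMultipleIndeterminacy_of_model`**, **`constantMultipleIndeterminacyOfSystems_of_model`** —
  (iii) for every `ζ` and the whole Corollary at the model, by abc-iut-L2-t4's PROVED reductions
  `constantMultipleIndeterminacy_of`, `constantMultipleIndeterminacyOfSystems_of` (p407037).

HONEST FRAMING: kernel-checked consequences of [FrdI] Thm. 5.2's explicit category for §5 data so modelled;
the hypotheses are print's own sentences read at the model plus `hEnd` (located, not hidden); nothing of
[EtTh] is asserted unconditionally; Cor. 5.12 is outside the [IUTchIII] Cor. 3.12 cone (sub-DAG §K "LOW") and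
no side is taken on Cor. 3.12 or on any author; typed ≠ proved except the theorems below.
-/

namespace Literature.AnabelianGeometry.EtaleTheta

open CategoryTheory Opposite
open Literature.AlgebraicGeometry.Frobenioids

universe w v u

namespace ConstantMultiple

/-! ### Model-level core: objects `(Z, cls)` and morphisms `(deg_Fr, Base, Div, u)` of [FrdI] Thm. 5.2 (i) -/

namespace Model

variable {D : Type u} [Category.{v} D] {Φ B : Dᵒᵖ ⥤ CommMonCat.{w}} {DivB : B ⟶ monoidGp Φ}

/-- The `Div` of (either half of) an isomorphism of the model Frobenioid is a unit of `Φ`, hence `0` when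
`Φ` is sharp at the base (read off `e ∘ e⁻¹ = id` with [FrdI] Rmk. 1.1.1; divisorial monoids are sharp,
[FrdI] Def. 1.1 (i)).  [cite: MochizukiFrdI2008, Thm. 5.2 (i) p.100] -/
theorem div_hom_eq_one_of_iso {X Y : ModelFrobenioid Φ B DivB} (hΦ : IsSharp (Φ.obj (op X.base)))
    (e : X ≅ Y) : ModelFrobenioid.div e.hom = 1 := by
  apply hΦ.eq_one_of_isUnit
  have h := congrArg ModelFrobenioid.div e.hom_inv_id
  rw [ModelFrobenioid.div_comp, ModelFrobenioid.div_id, (ModelFrobenioid.degFr_hom_eq_one e).2,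
    PNat.one_coe, pow_one] at h
  exact IsUnit.of_mul_eq_one_right _ h

/-- **A principal object is not isomorphic to an object whose class is not principal** (the step "`B_N`,
`B_{N'}` are non-isomorphic … to the Frobenius-trivial object `A_N`", Cor. 5.12 proof p.341 l.8–9 (PDF p.115),
at the model): if `cls(A) = Div_B(b)` and `cls(X) ∉ Div_B(B(X^bs))`, then `A ≇ X` — the inverse half
`X → A` of an isomorphism is `(1, g, 0, u)` (sharpness of `Φ(X^bs)`), whose relation (d) reads
`cls(X) = g^*Div_B(b) + Div_B(u) = Div_B(g^*b · u)`.  [cite: MochizukiEtTh2009, Cor 5.12 proof p.341 (PDF p.115)] -/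
theorem isEmpty_iso_of_principal {A X : ModelFrobenioid Φ B DivB} (hΦ : IsSharp (Φ.obj (op X.base)))
    (hA : ∃ b : B.obj (op A.base), A.cls = divB Φ B DivB (op A.base) b)
    (hL : ∀ u : B.obj (op X.base), X.cls ≠ divB Φ B DivB (op X.base) u) : IsEmpty (A ≅ X) := by
  refine ⟨fun e => ?_⟩
  obtain ⟨b, hb⟩ := hA
  have hdeg : ModelFrobenioid.degFr e.inv = 1 := (ModelFrobenioid.degFr_hom_eq_one e).2
  have hdiv : ModelFrobenioid.div e.inv = 1 := div_hom_eq_one_of_iso hΦ e.symm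
  have hrel := ModelFrobenioid.rel e.inv
  rw [hdeg, PNat.one_coe, pow_one, hdiv, map_one, mul_one, hb, pullGp_divB, ← map_mul] at hrel
  exact hL _ hrel

/-- **The class of the codomain of a linear base-isomorphism out of a principal object is effective modulo
`Div_B`** (the model content of "the line bundle that determines the object `B_{N'}`" being cut out by the
section `s^⊓_{N'}` of the Frobenius-trivial `A_{N'}`, Cor. 5.12 proof p.341 l.6–8 (PDF p.115)): for
`s = (1, g, Div(s), u_s) : A' → B'` with `g` invertible and `cls(A') = Div_B(b)`, relation (d) gives
`cls(B') = (g⁻¹)^*Div(s) + Div_B((g⁻¹)^*(b · u_s⁻¹))` (`B(A'^bs)` group-like).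
[cite: MochizukiEtTh2009, Cor 5.12 proof p.341 (PDF p.115)] -/
theorem exists_cls_eq_of_mul_divB {A' B' : ModelFrobenioid Φ B DivB} (s : A' ⟶ B')
    (hBg : IsGroupLike (B.obj (op A'.base)))
    (hA : ∃ b : B.obj (op A'.base), A'.cls = divB Φ B DivB (op A'.base) b)
    (hs : ModelFrobenioid.degFr s = 1) [IsIso (ModelFrobenioid.baseMap s)] :
    ∃ (x : Φ.obj (op B'.base)) (v : (B.obj (op B'.base))ˣ),
      B'.cls = Algebra.GrothendieckGroup.of x * divB Φ B DivB (op B'.base) ↑v := by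
  obtain ⟨b, hb⟩ := hA
  obtain ⟨wb, hwb⟩ := hBg.isUnit b
  obtain ⟨w, hw⟩ := hBg.isUnit (ModelFrobenioid.unit s)
  have hrel := ModelFrobenioid.rel s
  rw [hs, PNat.one_coe, pow_one, hb, ← hw] at hrel
  -- `hrel : Div_B(b) · of(Div s) = g^* cls(B') · Div_B(w)`
  set g := ModelFrobenioid.baseMap s with hg
  have key : pullGp Φ g B'.cls = Algebra.GrothendieckGroup.of (ModelFrobenioid.div s) *
      divB Φ B DivB (op A'.base) (b * ↑w⁻¹) := by
    calc pullGp Φ g B'.cls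
        = pullGp Φ g B'.cls * (divB Φ B DivB (op A'.base) ↑w * divB Φ B DivB (op A'.base) ↑w⁻¹) := by
          rw [← map_mul, Units.mul_inv, map_one, mul_one]
      _ = (divB Φ B DivB (op A'.base) b * Algebra.GrothendieckGroup.of (ModelFrobenioid.div s)) *
            divB Φ B DivB (op A'.base) ↑w⁻¹ := by rw [← mul_assoc, ← hrel]
      _ = Algebra.GrothendieckGroup.of (ModelFrobenioid.div s) *
            divB Φ B DivB (op A'.base) (b * ↑w⁻¹) := by rw [map_mul, mul_comm (divB Φ B DivB _ b), mul_assoc]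
  -- the unit `(g⁻¹)^*(b · w⁻¹)` of `B(B'^bs)`
  let v : (B.obj (op B'.base))ˣ := Units.map (pull B (inv g)) (wb * w⁻¹)
  refine ⟨pull Φ (inv g) (ModelFrobenioid.div s), v, ?_⟩
  have hv : (↑v : B.obj (op B'.base)) = pull B (inv g) (b * ↑w⁻¹) := by
    simp only [v, Units.coe_map, Units.val_mul, hwb]
  calc B'.cls = pullGp Φ (inv g) (pullGp Φ g B'.cls) := (PreFrobenioid.pullGp_inv_pullGp g B'.cls).symm
    _ = Algebra.GrothendieckGroup.of (pull Φ (inv g) (ModelFrobenioid.div s)) *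
          divB Φ B DivB (op B'.base) ↑v := by
        rw [key, map_mul, PreFrobenioid.pullGp_of', ModelFrobenioid.pullGp_divB_pull, hv]

/-- **(ii) at the model: a linear morphism from an isometry of any degree** (Cor. 5.12 proof p.341 l.6–8
(PDF p.115): "by multiplying by the `(M−1)`-th tensor power of the section of line bundles that determines …
`s^⊓_{N'}` … we obtain a linear morphism `ι : B_{N'} → B_N`"): if `β = (d, f, 0, u_β) : B' → B` and
`cls(B') = of(x) + Div_B(v)`, then `ι := (1, f, (d−1)·x, u_β − (d−1)·v) : B' → B` satisfies relation (d).
[cite: MochizukiEtTh2009, Cor 5.12 (ii) p.340–341 (PDF pp.114–115)] -/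
theorem exists_linear_of_div_eq_one {B' Bo : ModelFrobenioid Φ B DivB} (β : B' ⟶ Bo)
    (hβ : ModelFrobenioid.div β = 1)
    (hcls : ∃ (x : Φ.obj (op B'.base)) (v : (B.obj (op B'.base))ˣ),
      B'.cls = Algebra.GrothendieckGroup.of x * divB Φ B DivB (op B'.base) ↑v) :
    ∃ ι : B' ⟶ Bo, ModelFrobenioid.degFr ι = 1 := by
  obtain ⟨x, v, hx⟩ := hcls
  set d : ℕ := (ModelFrobenioid.degFr β : ℕ) - 1 with hd
  have hd' : (ModelFrobenioid.degFr β : ℕ) = d + 1 := (Nat.sub_add_cancel (ModelFrobenioid.degFr β).pos).symm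
  have hrel := ModelFrobenioid.rel β
  rw [hβ, map_one, mul_one, hd'] at hrel
  -- `hrel : cls(B')^(d+1) = f^* cls(B) · Div_B(u_β)`
  have hofx : Algebra.GrothendieckGroup.of x = B'.cls * divB Φ B DivB (op B'.base) ↑v⁻¹ := by
    calc Algebra.GrothendieckGroup.of x
        = Algebra.GrothendieckGroup.of x *
            (divB Φ B DivB (op B'.base) ↑v * divB Φ B DivB (op B'.base) ↑v⁻¹) := by
          rw [← map_mul, Units.mul_inv, map_one, mul_one]
      _ = B'.cls * divB Φ B DivB (op B'.base) ↑v⁻¹ := by rw [← mul_assoc, ← hx]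
  refine ⟨ModelFrobenioid.mkHom B' Bo 1 (ModelFrobenioid.baseMap β) (x ^ d)
    (ModelFrobenioid.unit β * (↑v⁻¹) ^ d) ?_, rfl⟩
  rw [PNat.one_coe, pow_one, map_pow, hofx, mul_pow, ← mul_assoc, ← pow_succ', hrel, map_mul, map_pow,
    mul_assoc]

/-- **(i) at the model, the step `B_N ≇ B_{N'}`** (Cor. 5.12 proof p.340 l.−8 – p.341 l.9 (PDF pp.114–115)).
Inputs: `β = (d, β^bs, 0, u) : B' → B` an isometry of degree `d ≥ 2` ("the pull-back via `B^bs_{N'} → B^bs_N` of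
the line bundle that determines `B_N` is isomorphic to the `M`-th tensor power of the line bundle that
determines `B_{N'}`"); "all positive tensor powers of [the line bundle of `B_{N'}`] are nontrivial":
`cls(B')^k ∉ Div_B(B(B'^bs))` for `k ≥ 1`; "the isomorphism classes of these line bundles are preserved by
arbitrary automorphisms of `B^bs_N`": every automorphism of `B^bs` lifts to an automorphism of `B`
(Aut-ampleness); every `D`-endomorphism of `B^bs` is an isomorphism (print's tacit input, see the header);
`Φ(B^bs)` sharp.  Argument: an isomorphism `h : B ⥲ B'` yields the `D`-endomorphism `φ := h^bs ∘ β^bs` of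
`B^bs`, an automorphism by `hEnd`, lifted to `G ∈ Aut_C(B)`; then `ψ := h ∘ G⁻¹ ∘ β` is a base-identity isometric
endomorphism of `B'` of degree `d`, whose relation (d) reads `cls(B')^{d−1} = Div_B(u_ψ)` — a trivial positive
power.  [cite: MochizukiEtTh2009, Cor 5.12 (i) proof p.340–341 (PDF pp.114–115)] -/
theorem isEmpty_iso_of_isometry {B' Bo : ModelFrobenioid Φ B DivB} (β : B' ⟶ Bo)
    (hβ : ModelFrobenioid.div β = 1) (hd : 2 ≤ (ModelFrobenioid.degFr β : ℕ))
    (hΦ : IsSharp (Φ.obj (op Bo.base)))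
    (hAmp : ∀ g : Bo.base ≅ Bo.base, ∃ G : Bo ≅ Bo, ModelFrobenioid.baseMap G.hom = g.hom)
    (hEnd : ∀ φ : Bo.base ⟶ Bo.base, IsIso φ)
    (hL : ∀ k : ℕ, 0 < k → ∀ u : B.obj (op B'.base), B'.cls ^ k ≠ divB Φ B DivB (op B'.base) u) :
    IsEmpty (Bo ≅ B') := by
  refine ⟨fun h => ?_⟩
  -- the base halves of `h`
  have hg₁₂ : ModelFrobenioid.baseMap h.inv ≫ ModelFrobenioid.baseMap h.hom = 𝟙 B'.base := by
    rw [← ModelFrobenioid.baseMap_comp, h.inv_hom_id, ModelFrobenioid.baseMap_id]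
  -- the `D`-endomorphism `φ := h^bs ∘ β^bs` of `B^bs`, an automorphism by `hEnd`, lifted by Aut-ampleness
  set φ : Bo.base ⟶ Bo.base := ModelFrobenioid.baseMap h.hom ≫ ModelFrobenioid.baseMap β with hφ
  haveI : IsIso φ := hEnd φ
  obtain ⟨G, hG⟩ := hAmp (asIso φ)
  rw [asIso_hom] at hG
  have hGinv : inv φ = ModelFrobenioid.baseMap G.inv := by
    apply IsIso.inv_eq_of_hom_inv_id
    rw [← hG, ← ModelFrobenioid.baseMap_comp, G.hom_inv_id, ModelFrobenioid.baseMap_id]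
  have hβbase : ModelFrobenioid.baseMap β = ModelFrobenioid.baseMap h.inv ≫ φ := by
    rw [hφ, ← Category.assoc, hg₁₂, Category.id_comp]
  -- the endomorphism `ψ := h ∘ G⁻¹ ∘ β` of `B'`
  set χ : Bo ≅ B' := G.symm ≪≫ h with hχ
  set ψ : B' ⟶ B' := β ≫ χ.hom with hψ
  have hχdeg : ModelFrobenioid.degFr χ.hom = 1 := (ModelFrobenioid.degFr_hom_eq_one χ).1
  have hχdiv : ModelFrobenioid.div χ.hom = 1 := div_hom_eq_one_of_iso hΦ χ
  have hψdeg : ModelFrobenioid.degFr ψ = ModelFrobenioid.degFr β := by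
    rw [hψ, ModelFrobenioid.degFr_comp, hχdeg, one_mul]
  have hψdiv : ModelFrobenioid.div ψ = 1 := by
    rw [hψ, ModelFrobenioid.div_comp, hχdiv, map_one, hβ, one_pow, mul_one]
  have hψbase : ModelFrobenioid.baseMap ψ = 𝟙 B'.base := by
    rw [hψ, ModelFrobenioid.baseMap_comp, hχ, Iso.trans_hom, Iso.symm_hom, ModelFrobenioid.baseMap_comp,
      ← hGinv, hβbase, Category.assoc, IsIso.hom_inv_id_assoc, hg₁₂]
  -- relation (d) of `ψ`: `cls(B')^d = cls(B') · Div_B(u_ψ)`, i.e. `cls(B')^(d-1) = Div_B(u_ψ)`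
  have hrel := ModelFrobenioid.rel ψ
  rw [hψdeg, hψdiv, hψbase, map_one, mul_one, pullGp_id] at hrel
  obtain ⟨d, hdd⟩ : ∃ d : ℕ, (ModelFrobenioid.degFr β : ℕ) = d + 1 :=
    ⟨(ModelFrobenioid.degFr β : ℕ) - 1, (Nat.sub_add_cancel (ModelFrobenioid.degFr β).pos).symm⟩
  rw [hdd, pow_succ'] at hrel
  have hk : B'.cls ^ d = divB Φ B DivB (op B'.base) (ModelFrobenioid.unit ψ) := mul_left_cancel hrel
  exact hL d (by omega) _ hk

/-- **Cor. 5.12 (i) at the model, assembled**: `A ≇ B`, `A ≇ B'`, `B ≇ B'` for a principal `A`, an isometry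
`β : B' → B` of degree `≥ 2`, non-principal (powers of the) classes of `B`, `B'`, `B` Aut-ample with
`End_D(B^bs) = Aut_D(B^bs)`, `Φ` sharp at the two bases.
[cite: MochizukiEtTh2009, Cor 5.12 (i) p.339 (PDF p.113), proof p.340–341 (PDF pp.114–115)] -/
theorem isoClassesDistinct_core {A B' Bo : ModelFrobenioid Φ B DivB} (β : B' ⟶ Bo)
    (hβ : ModelFrobenioid.div β = 1) (hd : 2 ≤ (ModelFrobenioid.degFr β : ℕ))
    (hΦo : IsSharp (Φ.obj (op Bo.base))) (hΦ' : IsSharp (Φ.obj (op B'.base)))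
    (hA : ∃ b : B.obj (op A.base), A.cls = divB Φ B DivB (op A.base) b)
    (hAmp : ∀ g : Bo.base ≅ Bo.base, ∃ G : Bo ≅ Bo, ModelFrobenioid.baseMap G.hom = g.hom)
    (hEnd : ∀ φ : Bo.base ⟶ Bo.base, IsIso φ)
    (hL : ∀ u : B.obj (op Bo.base), Bo.cls ≠ divB Φ B DivB (op Bo.base) u)
    (hL' : ∀ k : ℕ, 0 < k → ∀ u : B.obj (op B'.base), B'.cls ^ k ≠ divB Φ B DivB (op B'.base) u) :
    IsEmpty (A ≅ Bo) ∧ IsEmpty (A ≅ B') ∧ IsEmpty (Bo ≅ B') :=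
  ⟨isEmpty_iso_of_principal hΦo hA hL,
    isEmpty_iso_of_principal hΦ' hA (fun u h => hL' 1 one_pos u (by rw [pow_one]; exact h)),
    isEmpty_iso_of_isometry β hβ hd hΦo hAmp hEnd hL'⟩

end Model

/-! ### Cor. 5.12 (i), (ii), (iii) for §5 data over the model Frobenioid -/

namespace RootMorphismData

variable {D : Type u} [Category.{v} D] {Φ B : Dᵒᵖ ⥤ CommMonCat.{w}} {DivB : B ⟶ monoidGp Φ}
  {𝔉 : ThetaFrobenioid.{w} (ModelFrobenioid Φ B DivB) D} {V : FrobenioidThetaBiKummer.BiKummerVocabStub 𝔉}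
  (R : RootMorphismData 𝔉 V)

/-- **[EtTh] Cor. 5.12 (ii) at the MODEL** (F-0503 instance form): for §5 data over `ModelFrobenioid Φ B Div_B`
whose operations are the model's, with `B` group-like ([FrdI] Thm. 5.2 (ii)), "the Frobenius-trivial object"
`A_{N'}` ([FrdI] Def. 1.2 (iv); Def. 4.1 (iv) (a) / Prop. 4.2 (iii): the `N'`-domain) and `s^⊓_{N'}` a pre-step
(Prop. 4.2 (iii)), "there exists a linear morphism `ι : B_{N'} → B_N`" (p.340 (PDF p.114)) — by print's own
construction (p.341 l.6–8 (PDF p.115)), `Model.exists_linear_of_div_eq_one`.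
[cite: MochizukiEtTh2009, Cor 5.12 (ii) p.340 (PDF p.114), proof p.341 (PDF p.115)] -/
theorem existsLinearIota_of_model (h𝔉 : 𝔉.pre = PreFrobenioidData.ofModel Φ B DivB)
    (hBg : Objectwise (fun M _ => IsGroupLike M) B)
    (hA' : 𝔉.IsFrobeniusTrivial R.AN') (hs' : 𝔉.IsPreStep R.sCap') : ExistsLinearIota R := by
  have hβ : 𝔉.IsIsometry R.β := R.isIsometry_β
  revert hA' hs' hβ
  show 𝔉.pre.IsFrobeniusTrivial R.AN' → 𝔉.pre.IsPreStep R.sCap' → 𝔉.pre.IsIsometry R.β →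
    ∃ ι : R.BN' ⟶ 𝔉.BN, 𝔉.pre.IsLinear ι
  rw [h𝔉]
  intro hA' hs' hβ
  obtain ⟨b, hb⟩ := ModelFrobenioid.exists_cls_eq_divB_of_isFrobeniusTrivial R.AN'
    ((PreFrobenioidData.ofFunctor_isFrobeniusTrivial _ _).mp hA')
  haveI : IsIso (ModelFrobenioid.baseMap R.sCap') := hs'.2
  obtain ⟨ι, hι⟩ := Model.exists_linear_of_div_eq_one R.β hβ
    (Model.exists_cls_eq_of_mul_divB R.sCap' (hBg _) ⟨b, hb⟩ hs'.1)
  exact ⟨ι, hι⟩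

/-- **[EtTh] Cor. 5.12 (i) at the MODEL** (F-0505 instance form): for §5 data over `ModelFrobenioid Φ B Div_B`
whose operations are the model's, with `Φ` divisorial ([FrdI] Thm. 5.2 (ii)), "The isomorphism classes of
`A_N`, `B_N`, and `B_{N'}` are distinct" (p.339 (PDF p.113)) follows from the inputs of the printed proof
(p.340 l.−8 – p.341 l.9 (PDF pp.114–115)): `A_N` Frobenius-trivial; `B_N` Aut-ample (abc-iut-L2-t4's `AutAmpleBN`,
"preserved by arbitrary automorphisms of `B^bs_N`"; ⇐ `SgpCapSection`, `Sec5AutAmple.lean`); "all positive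
tensor powers of these line bundles are nontrivial" in model form (`hL`: the class of `B_N` is not in
`Div_B(B(B_N^bs))`; `hL'`: no positive power of the class of `B_{N'}` is in `Div_B(B(B_{N'}^bs))`); and the
tacit `hEnd`: every `D`-endomorphism of `B_N^bs` is an isomorphism (see the file header for why it cannot be
dropped).  The isometry `β_{N,N'}` of degree `M = N'/N ≥ 2` is the datum (`two_le_degFr_β`).
[cite: MochizukiEtTh2009, Cor 5.12 (i) p.339 (PDF p.113), proof p.340–341 (PDF pp.114–115)] -/
theorem isoClassesDistinct_of_model (h𝔉 : 𝔉.pre = PreFrobenioidData.ofModel Φ B DivB)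
    (hΦd : Objectwise (fun M _ => IsDivisorial M) Φ)
    (hA : 𝔉.IsFrobeniusTrivial 𝔉.AN) (hAmp : 𝔉.AutAmpleBN)
    (hEnd : ∀ φ : 𝔉.base.obj 𝔉.BN ⟶ 𝔉.base.obj 𝔉.BN, IsIso φ)
    (hL : ∀ u : B.obj (op 𝔉.BN.base), 𝔉.BN.cls ≠ divB Φ B DivB (op 𝔉.BN.base) u)
    (hL' : ∀ k : ℕ, 0 < k → ∀ u : B.obj (op R.BN'.base),
      R.BN'.cls ^ k ≠ divB Φ B DivB (op R.BN'.base) u) :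
    IsoClassesDistinct R := by
  have hβ : 𝔉.IsIsometry R.β := R.isIsometry_β
  have hd : 2 ≤ (𝔉.degFr R.β : ℕ) := R.two_le_degFr_β
  revert hA hAmp hEnd hβ hd
  show 𝔉.pre.IsFrobeniusTrivial 𝔉.AN → Function.Surjective (𝔉.pre.base.mapAut 𝔉.BN) →
    (∀ φ : 𝔉.pre.base.obj 𝔉.BN ⟶ 𝔉.pre.base.obj 𝔉.BN, IsIso φ) → 𝔉.pre.IsIsometry R.β →
    2 ≤ (𝔉.pre.degFr R.β : ℕ) → IsoClassesDistinct R
  rw [h𝔉]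
  intro hA hAmp hEnd hβ hd
  obtain ⟨b, hb⟩ := ModelFrobenioid.exists_cls_eq_divB_of_isFrobeniusTrivial 𝔉.AN
    ((PreFrobenioidData.ofFunctor_isFrobeniusTrivial _ _).mp hA)
  have hAmp' : ∀ g : 𝔉.BN.base ≅ 𝔉.BN.base, ∃ G : 𝔉.BN ≅ 𝔉.BN, ModelFrobenioid.baseMap G.hom = g.hom :=
    fun g => by
      obtain ⟨G, hG⟩ := hAmp g
      exact ⟨G, congrArg Iso.hom hG⟩
  exact Model.isoClassesDistinct_core R.β hβ hd (hΦd _).isSharp (hΦd _).isSharp ⟨b, hb⟩ hAmp'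
    (fun φ => hEnd φ) hL hL'

/-- **[EtTh] Cor. 5.12 (iii) at the MODEL, for every `ζ : B_{N'} → B_N`** (F-0501 instance form): from (i) at
the model (`isoClassesDistinct_of_model`) by abc-iut-L2-t4's PROVED reduction `constantMultipleIndeterminacy_of`
("in light of assertion (i), assertion (iii) follows immediately from Lemma 5.11", p.341 (PDF p.115)).
[cite: MochizukiEtTh2009, Cor 5.12 (iii) p.340 (PDF p.114), proof p.341 (PDF p.115)] -/
theorem constantMultipleIndeterminacy_of_model (h𝔉 : 𝔉.pre = PreFrobenioidData.ofModel Φ B DivB)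
    (hΦd : Objectwise (fun M _ => IsDivisorial M) Φ)
    (hA : 𝔉.IsFrobeniusTrivial 𝔉.AN) (hAmp : 𝔉.AutAmpleBN)
    (hEnd : ∀ φ : 𝔉.base.obj 𝔉.BN ⟶ 𝔉.base.obj 𝔉.BN, IsIso φ)
    (hL : ∀ u : B.obj (op 𝔉.BN.base), 𝔉.BN.cls ≠ divB Φ B DivB (op 𝔉.BN.base) u)
    (hL' : ∀ k : ℕ, 0 < k → ∀ u : B.obj (op R.BN'.base),
      R.BN'.cls ^ k ≠ divB Φ B DivB (op R.BN'.base) u)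
    (ζ : R.BN' ⟶ 𝔉.BN) : ConstantMultipleIndeterminacy R ζ :=
  constantMultipleIndeterminacy_of R (R.isoClassesDistinct_of_model h𝔉 hΦd hA hAmp hEnd hL hL') ζ

/-- **[EtTh] Cor. 5.12, all of (i), (ii), (iii), at the MODEL** (F-0502 instance form): the conjunction
`ConstantMultipleIndeterminacyOfSystems R` from the inputs of `isoClassesDistinct_of_model` and
`existsLinearIota_of_model`, by abc-iut-L2-t4's PROVED `constantMultipleIndeterminacyOfSystems_of`.
[cite: MochizukiEtTh2009, Cor 5.12 p.339–341 (PDF pp.113–115)] -/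
theorem constantMultipleIndeterminacyOfSystems_of_model (h𝔉 : 𝔉.pre = PreFrobenioidData.ofModel Φ B DivB)
    (hΦd : Objectwise (fun M _ => IsDivisorial M) Φ) (hBg : Objectwise (fun M _ => IsGroupLike M) B)
    (hA : 𝔉.IsFrobeniusTrivial 𝔉.AN) (hA' : 𝔉.IsFrobeniusTrivial R.AN') (hs' : 𝔉.IsPreStep R.sCap')
    (hAmp : 𝔉.AutAmpleBN) (hEnd : ∀ φ : 𝔉.base.obj 𝔉.BN ⟶ 𝔉.base.obj 𝔉.BN, IsIso φ)
    (hL : ∀ u : B.obj (op 𝔉.BN.base), 𝔉.BN.cls ≠ divB Φ B DivB (op 𝔉.BN.base) u)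
    (hL' : ∀ k : ℕ, 0 < k → ∀ u : B.obj (op R.BN'.base),
      R.BN'.cls ^ k ≠ divB Φ B DivB (op R.BN'.base) u) :
    ConstantMultipleIndeterminacyOfSystems R :=
  constantMultipleIndeterminacyOfSystems_of R (R.isoClassesDistinct_of_model h𝔉 hΦd hA hAmp hEnd hL hL')
    (R.existsLinearIota_of_model h𝔉 hBg hA' hs')

end RootMorphismData

end ConstantMultiple

end Literature.AnabelianGeometry.EtaleTheta
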